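import Summits.QuantumFields.YangMills.Theorems.BalabanUVNodesN16RankNUniformScalarMinimisers
import Summits.QuantumFields.YangMills.Theorems.BalabanUVNodesN16UniformScalarSlotKey
import HarnessLib

/-!
# YM-DAG node N16 (NE3), the re-keyed N07 in-edge — THE SLOT KEY (T9ˢ) ∧ (T8) ON THE UNIFORM-CURVATURE SCALAR DATA, AT EVERY RANK `n`: every `U(n)`-valued minimiser at a
# uniform-curvature scalar datum is a unitary gauge transform of the Landau field `U_{ω∕L^{2k},0,0} ⊗ 1_n`, hence (9)–(10)-regular on every slot cube at leaf-06's
# `torusVP ∕ lipGauge` letters; minimisers are unique up to (unitary, not necessarily periodic) gauge (file D of the g7 piece; extends g6 file 7 from `U(1)` to `U(n)`)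

Cell `pub-ymgap`, width seat `pub-ymgap-dag-n16-w2` (director-ym №197 ∕ HUMAN RULING D-0149), generation 7.  `--kind proof --supports stmt-QuantumFields-27366 --as helper`
(K3⁸, KEY MAP v2).  `bears_on: R4∕N16`, edge N07 → N16.  COUNT-NEUTRAL.

HONEST FRAMING.  Kernel bookkeeping over file C (`plaquettes_of_isMinimiser` at every rank), pub-balaban's lattice Poincaré lemma (`NE3EnergyRateFlatClass.
exists_unitary_gauge_eq_gaugeAct_flatCfg`: zero curvature on `ℤ^d` ⇒ pure gauge) and g6 file 7's `lipGauge` calculus (`lipGauge_gaugeAct_landau` needs only a UNITARY site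
gauge).  At rank `n ≥ 2` the gauge is unitary but NEITHER central NOR periodic in general (it carries the flat `U(n)` twist ∕ holonomy).  It is NOT [Balaban1985Variational]
Theorem 1 (general non-uniform data untouched); DischargeTest `stub_reg910Slot` itself is NOT closed (its datum ranges over ALL loose data); no K3⁸ v6 stub named or closed;
N16 ∕ N07 NOT discharged; counts UNMOVED (typed 28∕28 · discharged 5∕27 · A 5∕28).  R4 closes the conditional finite-𝕋⁴ rung `BalabanLadder.UV` only; NOT ℝ⁴ ∕ OS ∕ mass gap;
the YM mass gap (Clay) is NOT proved by any of this.

WHAT IS PROVED ([folklore] bookkeeping + cited shapes, 0 `sorry`, 0 `def`; REGIME = file C's rank-scaled leaf-05).  §1 `hol_mul_scalarCfg` (transport of `U·S` for a central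
scalar configuration `S`: `(U·S)(Γ) = U(Γ)·S(Γ)`), ★ `exists_unitary_gauge_of_hol_plaqWord_eq_scalarCfg` (**a `U(n)`-valued `U` with the SAME plaquette variables as a unitary
scalar configuration `S` is `S^{g}` for a unitary site gauge `g`** — `U·S⁻¹` is flat), ★★ `exists_unitary_gauge_of_isMinimiser` (every minimiser at a uniform-curvature scalar
datum is `(U_{ω∕L^{2k},0,0} ⊗ 1_n)^{g}`), ★★ `isMinimiser_unique_up_to_gauge` (two minimisers differ by a unitary gauge).  §2 ★★★ `regularity_of_isMinimiser_uniformScalar`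
(every minimiser is `Regularity (torusVP (d+2) L N (lipGauge (d+2) n) (k+1)) B₃ B₄ ε₁`-regular on every cube `K ≥ L^{k+1}`), ★★★ `reg910Slot_on_uniformScalar` (**THE (T9ˢ) TEXT
of `stub_reg910Slot` at `G := lipGauge`, datum over `sfClass ε₁ 0 ∩ 𝒟_unif`, EVERY RANK**, for every `C : B11Thm1.Consts` with `2 ≤ C.B₃` and `2·card n·C.B₃·C.a₁` in leaf-05's
regime), ★★ `reg910Slot_on_uniformScalar_saturation` (the same on the gauge saturation `𝒢_N·(sfClass ε₁ 0 ∩ 𝒟_unif)`), ★★★ `slotKey_bundle_on_uniformScalar` (rank `n`: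
`RadiiMono`, the (9)_{β₀=1} interface, (T9ˢ), (T8)).

DEPENDENCES (by name): file C (`plaquettes_of_isMinimiser`, `regime_aux`); g6 files 1 (`hol_plaqWord_landau`, `isUnitaryCfg_landau`), 2 (`exp_smul_one_comm`), 3
(`exists8Min_on_uniformScalar`, `abs_le_two_mul_norm_cexp_smul_one_sub_one`), 7 (`lipGauge_gaugeAct_landau`, `regularity_torusVP_lipGauge_of_factor`); pub-balaban
`NE3EnergyRateFlatClass.exists_unitary_gauge_eq_gaugeAct_flatCfg`; `N16SlotKeyGaugeQuotient.gaugeAct_gaugeAct`; `N16H7OfN07RecordSlot` (`lipGauge`, `radiiMono_lipGauge'`,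
`interface_lipGauge'`); `MinimalActionDictionary` (`torusVP`, `RadiiMono`, `cubeM`); `B11.Regularity`; `NE3EnergyShapes.IsUnitarySite`; `MinimalActionWitness.flatCfg`.
-/

open scoped BigOperators Matrix Matrix.Norms.L2Operator
open NormedSpace Finset

namespace Summit.QuantumFields.YangMills.BalabanUVNodes.N16RankNUniformScalarSlotKey

open Literature.MathematicalPhysics.QuantumFieldTheory.Balaban1983to89
open B7Prop1Explicit B7Prop2Explicit MatrixLog UnitaryModel
open T4AveragingDeficitWall hiding Site Plane Plaq Bond
open T4AveragingDeficitWallBoundary (scalarCfg val_hol_scalarCfg IsPeriodicCfg fin_zero_ne_one fin_one_ne_zero)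
open FederbushMean (cexp_smul_one norm_smul_one_eq)
open Summit.QuantumFields.BalabanUV.T4Continuum
open AveragingDeficitLatticeH2Prep (fd)
open MinimalActionSandwich (IsMinimiser)
open MinimalActionRate (sfClass)
open MinimalActionWitness (flatCfg)
open MinimalActionDictionary (torusVP RadiiMono cubeM cubeM_pos)
open NE3EnergyShapes (IsUnitarySite IsPeriodicSite)
open NE3EnergyRateFlatClass (exists_unitary_gauge_eq_gaugeAct_flatCfg)
open B11 (Regularity)
open Summit.QuantumFields.YangMills.BalabanUVNodes.N16H7OfN07RecordSlot (lipGauge radiiMono_lipGauge' interface_lipGauge')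
open Summit.QuantumFields.YangMills.BalabanUVNodes.N16SlotKeyGaugeQuotient (gaugeAct_gaugeAct isMinimiser_gaugeAct_blkGauge isUnitarySite_blkGauge
  regularity_torusVP_lipGauge_gaugeAct_iff)
open AveragingDeficitKDatum (gaugeAct_inv_gaugeAct)
open NE7EtaMinimiserGaugeCovariance (isUnitarySite_inv isPeriodicSite_inv)
open Summit.QuantumFields.YangMills.BalabanUVNodes.N16UniformScalarAverage (hol_plaqWord_landau isUnitaryCfg_landau)
open Summit.QuantumFields.YangMills.BalabanUVNodes.N16UniformScalarSeam (exp_smul_one_comm)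
open Summit.QuantumFields.YangMills.BalabanUVNodes.N16Exists8UniformScalar (exists8Min_on_uniformScalar abs_le_two_mul_norm_cexp_smul_one_sub_one)
open Summit.QuantumFields.YangMills.BalabanUVNodes.N16UniformScalarSlotKey (lipGauge_gaugeAct_landau regularity_torusVP_lipGauge_of_factor)
open Summit.QuantumFields.YangMills.BalabanUVNodes.N16RankNUniformScalarMinimisers (plaquettes_of_isMinimiser regime_aux)

noncomputable section

variable {d : ℕ} {n : Type} [Fintype n] [DecidableEq n]

/-! ## §1 Same plaquettes as a central scalar configuration ⇒ a unitary gauge transform of it; minimisers up to gauge -/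

/-- **Transport of a product with a CENTRAL scalar configuration**: for `S = e^{G}·1` and any `U`, `(U·S)(Γ) = U(Γ)·S(Γ)` along every word (the scalar factors commute past
everything). [cite: Balaban1985Averaging, (9) p.18] -/
theorem hol_mul_scalarCfg (U : B7Prop1Explicit.Site d → Fin d → (Matrix n n ℂ)ˣ) (G : B7Prop1Explicit.Site d → Fin d → ℂ) :
    ∀ (x : B7Prop1Explicit.Site d) (w : List (Letter d)),
      hol (fun y κ => U y κ * scalarCfg (n := n) G y κ) x w = hol U x w * hol (scalarCfg (n := n) G) x w
  | x, [] => by simp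
  | x, l :: w => by
    rw [hol_cons, hol_cons, hol_cons, hol_mul_scalarCfg U G (x + l.vec) w]
    -- the scalar bond variables and their inverses are central
    have hcen : ∀ (y : B7Prop1Explicit.Site d) (μ : Fin d) (X : Matrix n n ℂ),
        ((scalarCfg (n := n) G y μ : (Matrix n n ℂ)ˣ) : Matrix n n ℂ) * X = X * (scalarCfg (n := n) G y μ : (Matrix n n ℂ)ˣ) := fun y μ X => by
      rw [scalarCfg, val_expUnit]; exact exp_smul_one_comm _ _
    have hcen' : ∀ (y : B7Prop1Explicit.Site d) (μ : Fin d) (X : Matrix n n ℂ),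
        (((scalarCfg (n := n) G y μ)⁻¹ : (Matrix n n ℂ)ˣ) : Matrix n n ℂ) * X = X * (((scalarCfg (n := n) G y μ)⁻¹ : (Matrix n n ℂ)ˣ) : Matrix n n ℂ) := fun y μ X => by
      rw [Units.inv_mul_eq_iff_eq_mul, ← mul_assoc, hcen, mul_assoc, Units.mul_inv, mul_one]
    have hcomm : ∀ (V : (Matrix n n ℂ)ˣ) (y : B7Prop1Explicit.Site d), stepHol (scalarCfg (n := n) G) y l * V = V * stepHol (scalarCfg (n := n) G) y l := by
      intro V y
      apply Units.ext
      simp only [Units.val_mul, stepHol]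
      split_ifs
      · exact hcen _ _ _
      · exact hcen' _ _ _
    have hstep : stepHol (fun y κ => U y κ * scalarCfg (n := n) G y κ) x l = stepHol U x l * stepHol (scalarCfg (n := n) G) x l := by
      simp only [stepHol]
      split_ifs
      · rfl
      · rw [mul_inv_rev]; apply Units.ext; rw [Units.val_mul, Units.val_mul]; exact hcen' _ _ _
    rw [hstep, mul_assoc, mul_assoc, ← mul_assoc (stepHol (scalarCfg (n := n) G) x l), hcomm (hol U (x + l.vec) w) x, mul_assoc]

/-- **★ SAME PLAQUETTES AS A UNITARY SCALAR CONFIGURATION ⇒ A UNITARY GAUGE TRANSFORM OF IT**: if the `U(n)`-valued `U` and the unitary scalar configuration `S = e^{iG}·1_n` have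
the same plaquette variables, then `U = S^{g}` for a unitary site gauge `g` (`U·S⁻¹` is flat on `ℤ^d`, hence a pure gauge by pub-balaban's lattice Poincaré lemma; `g` is not
periodic in general — it carries the flat twist). [folklore] -/
theorem exists_unitary_gauge_of_hol_plaqWord_eq_scalarCfg [Nonempty n] {U : B7Prop1Explicit.Site d → Fin d → (Matrix n n ℂ)ˣ} (hU : IsUnitaryCfg U)
    (G : B7Prop1Explicit.Site d → Fin d → ℝ)
    (h : ∀ (x : B7Prop1Explicit.Site d) (κ μ : Fin d), κ ≠ μ →
      hol U x (plaqWord κ μ) = hol (scalarCfg (n := n) (fun y ν => ((G y ν : ℝ) : ℂ) * Complex.I)) x (plaqWord κ μ)) :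
    ∃ g : B7Prop1Explicit.Site d → (Matrix n n ℂ)ˣ, (∀ x, g x ∈ unitaryUnits (Matrix n n ℂ)) ∧
      U = gaugeAct g (scalarCfg (n := n) (fun y ν => ((G y ν : ℝ) : ℂ) * Complex.I)) := by
  -- the quotient `Q = U · S⁻¹ = U · e^{−iG}·1`
  set Q : B7Prop1Explicit.Site d → Fin d → (Matrix n n ℂ)ˣ := fun y κ => U y κ * scalarCfg (n := n) (fun y ν => -(((G y ν : ℝ) : ℂ) * Complex.I)) y κ with hQ
  have hSinv : ∀ y κ, scalarCfg (n := n) (fun y ν => -(((G y ν : ℝ) : ℂ) * Complex.I)) y κ = (scalarCfg (n := n) (fun y ν => ((G y ν : ℝ) : ℂ) * Complex.I) y κ)⁻¹ := by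
    intro y κ; apply Units.ext; simp only [scalarCfg, val_inv_expUnit, neg_smul]
  have hneg : (fun y ν => -(((G y ν : ℝ) : ℂ) * Complex.I)) = fun y ν => (((-G y ν : ℝ) : ℝ) : ℂ) * Complex.I := by
    funext y ν; push_cast; ring
  have hQU : IsUnitaryCfg Q := by
    intro y κ
    rw [hQ]
    refine (unitaryUnits (Matrix n n ℂ)).mul_mem (hU y κ) ?_
    rw [hneg]; exact MinimalActionClassSixNeg.isUnitaryCfg_scalarCfg_imag _ y κ
  have hQflat : ∀ (x : B7Prop1Explicit.Site d) (κ μ : Fin d), κ ≠ μ → hol Q x (plaqWord κ μ) = 1 := by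
    intro x κ μ hκμ
    rw [hQ, hol_mul_scalarCfg, h x κ μ hκμ, T4AveragingDeficitWallBoundary.hol_scalarCfg, T4AveragingDeficitWallBoundary.hol_scalarCfg]
    apply Units.ext
    rw [Units.val_mul, val_expUnit, val_expUnit, Units.val_one]
    letI : NormedAlgebra ℚ (Matrix n n ℂ) := NormedAlgebra.restrictScalars ℚ ℂ (Matrix n n ℂ)
    rw [← exp_add_of_commute (((Commute.refl (1 : Matrix n n ℂ)).smul_left _).smul_right _), ← add_smul]
    have hsum : ∀ (y : B7Prop1Explicit.Site d) (w : List (Letter d)),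
        asum (fun y ν => ((G y ν : ℝ) : ℂ) * Complex.I) y w + asum (fun y ν => -(((G y ν : ℝ) : ℂ) * Complex.I)) y w = 0 := by
      intro y w
      induction w generalizing y with
      | nil => simp
      | cons l w ih =>
        rw [asum_cons, asum_cons]
        have := ih (y + l.vec)
        rcases l with ⟨ν, _ | _⟩
        · simp only [stepA_false] at *; linear_combination this
        · simp only [stepA_true] at *; linear_combination this
    rw [hsum, zero_smul, exp_zero]
  obtain ⟨g, hg, hQg⟩ := exists_unitary_gauge_eq_gaugeAct_flatCfg hQU hQflat
  refine ⟨g, hg, funext fun x => funext fun κ => ?_⟩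
  -- `U = Q · S = (g · 1 · g⁻¹) · S = g · S · g⁻¹`
  have hQx : Q x κ = U x κ * (scalarCfg (n := n) (fun y ν => ((G y ν : ℝ) : ℂ) * Complex.I) x κ)⁻¹ := by simp only [hQ, hSinv]
  have hUx : U x κ = Q x κ * scalarCfg (n := n) (fun y ν => ((G y ν : ℝ) : ℂ) * Complex.I) x κ := by
    rw [hQx, mul_assoc, inv_mul_cancel, mul_one]
  rw [hUx, hQg, gaugeAct, gaugeAct, flatCfg, mul_one, mul_assoc, mul_assoc]
  congr 1
  apply Units.ext
  rw [Units.val_mul, Units.val_mul, scalarCfg, val_expUnit]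
  exact (exp_smul_one_comm _ _).symm

section Minimisers

variable [Nonempty n] {L N k : ℕ} {ec ω : ℝ} {G : B7Prop1Explicit.Site (d + 2) → Fin (d + 2) → ℝ}

/-- **★★ AT EVERY RANK, EVERY MINIMISER IS A UNITARY GAUGE TRANSFORM OF THE LANDAU FIELD** `U_{ω∕L^{2k},0,0} ⊗ 1_n` (file C: its plaquette variables are the Landau field's;
§1: same plaquettes as a scalar configuration ⇒ unitary gauge transform; the gauge is not periodic ∕ not central in general). [cite: Balaban1985Variational, Thm 1 p.279] -/
theorem exists_unitary_gauge_of_isMinimiser (hL : 2 ≤ L) (hN : 1 ≤ N) (he0 : 0 ≤ ec) (he1n : 16 * C0 (d + 2) * (2 * Fintype.card n * ec) ≤ 3)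
    (he2n : 1024 * ((d + 2 : ℕ) + 1 : ℝ) * ((d + 2 : ℕ) + 4) * (L : ℝ) ^ 2 * (2 * Fintype.card n * ec) ≤ 1) (hωe : |ω| ≤ ec) (hωn : |Fintype.card n * ω| ≤ 1 / 2)
    (hP : IsPeriodicCfg (scalarCfg (n := n) (fun y ν => ((G y ν : ℝ) : ℂ) * Complex.I)) (N : ℤ))
    (hcurv : ∀ (x : B7Prop1Explicit.Site (d + 2)) (κ μ : Fin (d + 2)), κ ≠ μ →
      hol (scalarCfg (n := n) (fun y ν => ((G y ν : ℝ) : ℂ) * Complex.I)) x (plaqWord κ μ)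
        = expUnit ((((if κ = 0 ∧ μ = 1 then ω else if κ = 1 ∧ μ = 0 then -ω else 0 : ℝ) : ℂ) * Complex.I) • (1 : Matrix n n ℂ)))
    {U : B7Prop1Explicit.Site (d + 2) → Fin (d + 2) → (Matrix n n ℂ)ˣ}
    (hmin : IsMinimiser (d + 2) (sfClass (d + 2) L N ec) L N k (scalarCfg (n := n) (fun y ν => ((G y ν : ℝ) : ℂ) * Complex.I)) U) :
    ∃ g : B7Prop1Explicit.Site (d + 2) → (Matrix n n ℂ)ˣ, (∀ x, g x ∈ unitaryUnits (Matrix n n ℂ)) ∧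
      U = gaugeAct g (scalarCfg (n := n) (fun (x : B7Prop1Explicit.Site (d + 2)) (κ : Fin (d + 2)) =>
        ((if κ = 1 then (ω / (L : ℝ) ^ (2 * k)) * ((x 0 : ℤ) : ℝ) + 0 else if κ = 0 then (0 : ℝ) else 0 : ℝ) : ℂ) * Complex.I)) := by
  have hplaq := plaquettes_of_isMinimiser (n := n) hL hN he0 he1n he2n hωe hωn hP hcurv hmin
  have h := exists_unitary_gauge_of_hol_plaqWord_eq_scalarCfg (n := n) hmin.mem.1.1
    (fun (x : B7Prop1Explicit.Site (d + 2)) (κ : Fin (d + 2)) => (if κ = 1 then (ω / (L : ℝ) ^ (2 * k)) * ((x 0 : ℤ) : ℝ) + 0 else if κ = 0 then (0 : ℝ) else 0 : ℝ))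
    (fun x κ μ hκμ => by rw [hplaq x κ μ hκμ, hol_plaqWord_landau (f := ω / (L : ℝ) ^ (2 * k)) (a := 0) (c := 0) (fun _ _ => rfl)])
  exact h

/-- **★★ UNIQUENESS UP TO GAUGE AT EVERY RANK** (`𝒟_unif`): two minimisers at the same datum differ by a unitary site gauge (not periodic in general).
[cite: Balaban1985Variational, Thm 1 p.279] -/
theorem isMinimiser_unique_up_to_gauge (hL : 2 ≤ L) (hN : 1 ≤ N) (he0 : 0 ≤ ec) (he1n : 16 * C0 (d + 2) * (2 * Fintype.card n * ec) ≤ 3)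
    (he2n : 1024 * ((d + 2 : ℕ) + 1 : ℝ) * ((d + 2 : ℕ) + 4) * (L : ℝ) ^ 2 * (2 * Fintype.card n * ec) ≤ 1) (hωe : |ω| ≤ ec) (hωn : |Fintype.card n * ω| ≤ 1 / 2)
    (hP : IsPeriodicCfg (scalarCfg (n := n) (fun y ν => ((G y ν : ℝ) : ℂ) * Complex.I)) (N : ℤ))
    (hcurv : ∀ (x : B7Prop1Explicit.Site (d + 2)) (κ μ : Fin (d + 2)), κ ≠ μ →
      hol (scalarCfg (n := n) (fun y ν => ((G y ν : ℝ) : ℂ) * Complex.I)) x (plaqWord κ μ)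
        = expUnit ((((if κ = 0 ∧ μ = 1 then ω else if κ = 1 ∧ μ = 0 then -ω else 0 : ℝ) : ℂ) * Complex.I) • (1 : Matrix n n ℂ)))
    {U U' : B7Prop1Explicit.Site (d + 2) → Fin (d + 2) → (Matrix n n ℂ)ˣ}
    (hmin : IsMinimiser (d + 2) (sfClass (d + 2) L N ec) L N k (scalarCfg (n := n) (fun y ν => ((G y ν : ℝ) : ℂ) * Complex.I)) U)
    (hmin' : IsMinimiser (d + 2) (sfClass (d + 2) L N ec) L N k (scalarCfg (n := n) (fun y ν => ((G y ν : ℝ) : ℂ) * Complex.I)) U') :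
    ∃ g : B7Prop1Explicit.Site (d + 2) → (Matrix n n ℂ)ˣ, (∀ x, g x ∈ unitaryUnits (Matrix n n ℂ)) ∧ U' = gaugeAct g U := by
  obtain ⟨g₁, hg₁, h₁⟩ := exists_unitary_gauge_of_isMinimiser (n := n) hL hN he0 he1n he2n hωe hωn hP hcurv hmin
  obtain ⟨g₂, hg₂, h₂⟩ := exists_unitary_gauge_of_isMinimiser (n := n) hL hN he0 he1n he2n hωe hωn hP hcurv hmin'
  refine ⟨g₂ * g₁⁻¹, fun x => (unitaryUnits (Matrix n n ℂ)).mul_mem (hg₂ x) ((unitaryUnits (Matrix n n ℂ)).inv_mem (hg₁ x)), ?_⟩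
  rw [h₂, h₁, gaugeAct_gaugeAct, mul_assoc, inv_mul_cancel, mul_one]

/-! ## §2 Leaf-06's `Regularity` at the shape `lipGauge` for every minimiser, every rank; the (T9ˢ) text and the slot-key bundle on `𝒟_unif` -/

/-- **★★★ AT EVERY RANK, EVERY MINIMISER AT A UNIFORM-CURVATURE DATUM IS (9)–(10)-REGULAR ON EVERY LARGE CUBE** (`L ≥ 2`, `N ≥ 1`, rank-scaled leaf-05 regime for the class
radius `B₃ε₁`, `B₃ ≥ 2`, `B₄ > 0`): for an `N`-periodic scalar datum of uniform `(e₀,e₁)`-curvature `ω` with `|ω| ≤ 2ε₁` and `|card n·ω| ≤ 1∕2`, every minimiser `U` of run `k+1`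
over `sfClass (d+2) L N (B₃ε₁) (k+1)` and every cube `(y, K)` with `L^{k+1} ≤ K`: `Regularity (torusVP (d+2) L N (lipGauge (d+2) n) (k+1)) B₃ B₄ ε₁ U (y, K)` (the minimiser is a
UNITARY gauge transform of the Landau field `f = ω∕L^{2(k+1)}`, §1; g6 file 7's admissible factor). [cite: Balaban1985Variational, Thm 1 (9)–(10) p.279] -/
theorem regularity_of_isMinimiser_uniformScalar (hL : 2 ≤ L) (hN : 1 ≤ N) {B₃ B₄ ε₁ : ℝ} (hB₃ : 2 ≤ B₃) (hB₄ : 0 < B₄) (hε₁ : 0 < ε₁)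
    (he1n : 16 * C0 (d + 2) * (2 * Fintype.card n * (B₃ * ε₁)) ≤ 3) (he2n : 1024 * ((d + 2 : ℕ) + 1 : ℝ) * ((d + 2 : ℕ) + 4) * (L : ℝ) ^ 2 * (2 * Fintype.card n * (B₃ * ε₁)) ≤ 1)
    {ω : ℝ} (hωε : |ω| ≤ 2 * ε₁) (hωn : |Fintype.card n * ω| ≤ 1 / 2) {G : B7Prop1Explicit.Site (d + 2) → Fin (d + 2) → ℝ}
    (hP : IsPeriodicCfg (scalarCfg (n := n) (fun y ν => ((G y ν : ℝ) : ℂ) * Complex.I)) (N : ℤ))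
    (hcurv : ∀ (x : B7Prop1Explicit.Site (d + 2)) (κ μ : Fin (d + 2)), κ ≠ μ →
      hol (scalarCfg (n := n) (fun y ν => ((G y ν : ℝ) : ℂ) * Complex.I)) x (plaqWord κ μ)
        = expUnit ((((if κ = 0 ∧ μ = 1 then ω else if κ = 1 ∧ μ = 0 then -ω else 0 : ℝ) : ℂ) * Complex.I) • (1 : Matrix n n ℂ)))
    (k : ℕ) {U : B7Prop1Explicit.Site (d + 2) → Fin (d + 2) → (Matrix n n ℂ)ˣ}
    (hmin : IsMinimiser (d + 2) (sfClass (d + 2) L N (B₃ * ε₁)) L N (k + 1) (scalarCfg (n := n) (fun y ν => ((G y ν : ℝ) : ℂ) * Complex.I)) U)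
    (y : B7Prop1Explicit.Site (d + 2)) {K : ℕ} (hK : L ^ (k + 1) ≤ K) :
    Regularity (torusVP (d + 2) L N (lipGauge (d + 2) n) (k + 1)) B₃ B₄ ε₁ U (y, K) := by
  have hL1 : 1 ≤ L := by omega
  have hB0 : 0 < B₃ := by linarith
  have hωe : |ω| ≤ B₃ * ε₁ := hωε.trans (by nlinarith)
  obtain ⟨u, hu, hU⟩ := exists_unitary_gauge_of_isMinimiser (n := n) (k := k + 1) hL hN (by positivity) he1n he2n hωe hωn hP hcurv hmin
  set f : ℝ := ω / (L : ℝ) ^ (2 * (k + 1)) with hf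
  -- the Landau field (and its gauge transform `U`) is in `lipGauge` about `y` with radii `(|f|K, |f|, 0)`
  have hlip : lipGauge (d + 2) n U y K (|f| * K) |f| 0 := by rw [hU]; exact lipGauge_gaugeAct_landau (n := n) f hu y K
  -- the admissible factor `t = |ω|·K∕L^{k+1}` (`= |f|·K·L^{k+1}`)
  have hLk : (0 : ℝ) < (L : ℝ) ^ (k + 1) := by positivity
  have hKr : (L : ℝ) ^ (k + 1) ≤ (K : ℝ) := by exact_mod_cast hK
  have hK0 : (0 : ℝ) ≤ K := by positivity
  have habsf : |f| = |ω| / ((L : ℝ) ^ (k + 1)) ^ 2 := by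
    rw [hf, abs_div, mul_comm 2 (k + 1), pow_mul, abs_of_pos (by positivity : (0 : ℝ) < ((L : ℝ) ^ (k + 1)) ^ 2)]
  set t : ℝ := |ω| * (K : ℝ) / (L : ℝ) ^ (k + 1) with ht
  have ht0 : 0 ≤ t := by positivity
  have h0 : |f| * K ≤ t / (L : ℝ) ^ (k + 1) := le_of_eq (by rw [habsf, ht]; ring)
  have h1 : |f| ≤ t / ((L : ℝ) ^ (k + 1)) ^ 2 := by
    have hKA : 1 ≤ (K : ℝ) / (L : ℝ) ^ (k + 1) := by rw [le_div_iff₀ hLk]; linarith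
    calc |f| = |ω| / ((L : ℝ) ^ (k + 1)) ^ 2 * 1 := by rw [habsf, mul_one]
      _ ≤ |ω| / ((L : ℝ) ^ (k + 1)) ^ 2 * ((K : ℝ) / (L : ℝ) ^ (k + 1)) := mul_le_mul_of_nonneg_left hKA (by positivity)
      _ = t / ((L : ℝ) ^ (k + 1)) ^ 2 := by rw [ht]; ring
  have h2 : (0 : ℝ) ≤ t / ((L : ℝ) ^ (k + 1)) ^ 3 := by positivity
  have hlip' := radiiMono_lipGauge' U y K _ _ _ _ _ _ h0 h1 h2 hlip
  refine regularity_torusVP_lipGauge_of_factor (n := n) hL1 hB₄ hε₁ ht0 hlip' ?_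
  -- `|ω| K / L^{k+1} < B₃ (2K+1)/(2L^{k+1}) ε₁`
  rw [ht, cubeM, show B₃ * ((2 * (K : ℝ) + 1) / (2 * (L : ℝ) ^ (k + 1))) * ε₁ = (B₃ * ε₁ * (2 * K + 1) / 2) / (L : ℝ) ^ (k + 1) by ring,
    div_lt_div_iff_of_pos_right hLk]
  have hBe : 0 < B₃ * ε₁ := by positivity
  nlinarith [mul_le_mul_of_nonneg_right hωe hK0]

/-- **★★★ THE (T9ˢ) TEXT OF `stub_reg910Slot` ON `𝒟_unif`, AT EVERY RANK** (binder for binder at `G := lipGauge (d+2) n`; every `C : B11Thm1.Consts` with `2 ≤ C.B₃` and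
`2·card n·C.B₃·C.a₁` in leaf-05's regime): for every run `k+1`, every `0 < ε₁ ≤ C.a₁`, every `ε₁`-loose datum in `𝒟_unif` and every `U(n)`-valued minimiser `U` over
`sfClass (d+2) L N (C.B₃ε₁) (k+1)`: `Regularity` on the slot cube `(x, L^{k+1} − 1 + L^{k+1} + 2)` about EVERY site. [cite: Balaban1985Variational, Thm 1 (9)–(10) p.279] -/
theorem reg910Slot_on_uniformScalar (hL : 2 ≤ L) (hN : 1 ≤ N) (C : B11Thm1.Consts) (hB : 2 ≤ C.B₃)
    (hr1 : 16 * C0 (d + 2) * (2 * Fintype.card n * (C.B₃ * C.a₁)) ≤ 3)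
    (hr2 : 1024 * ((d + 2 : ℕ) + 1 : ℝ) * ((d + 2 : ℕ) + 4) * (L : ℝ) ^ 2 * (2 * Fintype.card n * (C.B₃ * C.a₁)) ≤ 1) :
    ∀ (k : ℕ) (ε₁ : ℝ), 0 < ε₁ → ε₁ ≤ C.a₁ → ∀ V U : B7Prop1Explicit.Site (d + 2) → Fin (d + 2) → (Matrix n n ℂ)ˣ, V ∈ sfClass (d + 2) L N ε₁ 0 →
      V ∈ {V | ∃ (G : B7Prop1Explicit.Site (d + 2) → Fin (d + 2) → ℝ) (ω : ℝ), |ω| ≤ 1 ∧ V = scalarCfg (n := n) (fun x κ => ((G x κ : ℝ) : ℂ) * Complex.I) ∧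
        ∀ (x : B7Prop1Explicit.Site (d + 2)) (κ μ : Fin (d + 2)), κ ≠ μ → hol V x (plaqWord κ μ)
          = expUnit ((((if κ = 0 ∧ μ = 1 then ω else if κ = 1 ∧ μ = 0 then -ω else 0 : ℝ) : ℂ) * Complex.I) • (1 : Matrix n n ℂ))} →
      IsMinimiser (d + 2) (sfClass (d + 2) L N (C.B₃ * ε₁)) L N (k + 1) V U →
        ∀ x : B7Prop1Explicit.Site (d + 2), Regularity (torusVP (d + 2) L N (lipGauge (d + 2) n) (k + 1)) C.B₃ C.B₄ ε₁ U (x, L ^ (k + 1) - 1 + L ^ (k + 1) + 2) := by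
  intro k ε₁ hε₁ hε₁a V U hV hD hmin x
  obtain ⟨G, ω, hω1, rfl, hcurv⟩ := hD
  have hB0 : 0 < C.B₃ := C.B₃_pos
  have hc1 : (1 : ℝ) ≤ Fintype.card n := by exact_mod_cast Fintype.card_pos
  have hsmall := hV.2.2 0 0 1 fin_zero_ne_one
  rw [hcurv 0 0 1 fin_zero_ne_one, val_expUnit, ← cexp_smul_one, pow_zero, one_pow, div_one] at hsmall
  simp only [true_and, if_true] at hsmall
  have hωε : |ω| ≤ 2 * ε₁ :=
    (abs_le_two_mul_norm_cexp_smul_one_sub_one (hω1.trans (by have := Real.pi_gt_three; linarith))).trans (by linarith)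
  have hε : 2 * Fintype.card n * (C.B₃ * ε₁) ≤ 2 * Fintype.card n * (C.B₃ * C.a₁) :=
    mul_le_mul_of_nonneg_left (mul_le_mul_of_nonneg_left hε₁a hB0.le) (by positivity)
  -- `|card n · ω| ≤ 2 card n ε₁ ≤ card n · C.B₃ · C.a₁ ≤ 1/3` (file C's regime bookkeeping)
  have hnec := (regime_aux (n := n) (d := d) hL (mul_nonneg hB0.le C.a₁_pos.le) hr2).1
  have hωn : |Fintype.card n * ω| ≤ 1 / 2 := by
    rw [abs_mul, abs_of_pos (by positivity : (0 : ℝ) < Fintype.card n)]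
    have h2 : (Fintype.card n : ℝ) * |ω| ≤ Fintype.card n * (2 * ε₁) := mul_le_mul_of_nonneg_left hωε (by positivity)
    have h3 : (2 : ℝ) * ε₁ ≤ C.B₃ * C.a₁ := by nlinarith
    nlinarith
  have hPer : IsPeriodicCfg (scalarCfg (n := n) (fun x κ => ((G x κ : ℝ) : ℂ) * Complex.I)) (N : ℤ) := by simpa using hV.2.1
  refine regularity_of_isMinimiser_uniformScalar (n := n) hL hN hB C.B₄_pos hε₁ ?_ ?_ hωε hωn hPer hcurv k hmin x (by omega)
  · exact (mul_le_mul_of_nonneg_left hε (by have := C0_pos (d + 2); positivity)).trans hr1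
  · exact (mul_le_mul_of_nonneg_left hε (by positivity)).trans hr2

/-- **★★ … AND ON THEIR GAUGE SATURATION** (this seat's g5 `isMinimiser_gaugeAct_blkGauge` ∕ `regularity_torusVP_lipGauge_gaugeAct_iff`): the same (T9ˢ) text, every rank, with the
datum ranging over the unitary `N`-periodic gauge orbits `𝒢_N · (sfClass ε₁ 0 ∩ 𝒟_unif)` — a minimiser at `V₀^v` pulls back to a minimiser at `V₀`, and `Regularity` at `lipGauge`
does not see the gauge. [cite: Balaban1985Variational, Thm 1 (9)–(10) p.279] -/
theorem reg910Slot_on_uniformScalar_saturation (hL : 2 ≤ L) (hN : 1 ≤ N) (C : B11Thm1.Consts) (hB : 2 ≤ C.B₃)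
    (hr1 : 16 * C0 (d + 2) * (2 * Fintype.card n * (C.B₃ * C.a₁)) ≤ 3)
    (hr2 : 1024 * ((d + 2 : ℕ) + 1 : ℝ) * ((d + 2 : ℕ) + 4) * (L : ℝ) ^ 2 * (2 * Fintype.card n * (C.B₃ * C.a₁)) ≤ 1) :
    ∀ (k : ℕ) (ε₁ : ℝ), 0 < ε₁ → ε₁ ≤ C.a₁ → ∀ V U : B7Prop1Explicit.Site (d + 2) → Fin (d + 2) → (Matrix n n ℂ)ˣ,
      V ∈ {W | ∃ V₀ : B7Prop1Explicit.Site (d + 2) → Fin (d + 2) → (Matrix n n ℂ)ˣ, V₀ ∈ sfClass (d + 2) L N ε₁ 0 ∧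
        (∃ (G : B7Prop1Explicit.Site (d + 2) → Fin (d + 2) → ℝ) (ω : ℝ), |ω| ≤ 1 ∧ V₀ = scalarCfg (n := n) (fun x κ => ((G x κ : ℝ) : ℂ) * Complex.I) ∧
          ∀ (x : B7Prop1Explicit.Site (d + 2)) (κ μ : Fin (d + 2)), κ ≠ μ → hol V₀ x (plaqWord κ μ)
            = expUnit ((((if κ = 0 ∧ μ = 1 then ω else if κ = 1 ∧ μ = 0 then -ω else 0 : ℝ) : ℂ) * Complex.I) • (1 : Matrix n n ℂ))) ∧
        ∃ u : B7Prop1Explicit.Site (d + 2) → (Matrix n n ℂ)ˣ, IsUnitarySite u ∧ IsPeriodicSite u (N : ℤ) ∧ W = gaugeAct u V₀} →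
      IsMinimiser (d + 2) (sfClass (d + 2) L N (C.B₃ * ε₁)) L N (k + 1) V U →
        ∀ x : B7Prop1Explicit.Site (d + 2), Regularity (torusVP (d + 2) L N (lipGauge (d + 2) n) (k + 1)) C.B₃ C.B₄ ε₁ U (x, L ^ (k + 1) - 1 + L ^ (k + 1) + 2) := by
  intro k ε₁ hε₁ hε₁a V U hV hU x
  obtain ⟨V₀, hV₀, hD, v, hv, hvP, rfl⟩ := hV
  -- the minimiser pulled back to the datum `V₀`
  have hback := isMinimiser_gaugeAct_blkGauge (show 1 ≤ L by omega) hU (isUnitarySite_inv hv) (isPeriodicSite_inv hvP)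
  rw [gaugeAct_inv_gaugeAct] at hback
  have hreg := reg910Slot_on_uniformScalar (n := n) hL hN C hB hr1 hr2 k ε₁ hε₁ hε₁a V₀ _ hV₀ hD hback x
  exact (regularity_torusVP_lipGauge_gaugeAct_iff (isUnitarySite_blkGauge (L ^ (k + 1)) (isUnitarySite_inv hv)) L N (k + 1) C.B₃ C.B₄ ε₁ U x _).mp hreg

/-- **★★★ THE SLOT-KEY BUNDLE ON `𝒟_unif`, AT EVERY RANK**: with `G := lipGauge (d+2) n` and every `C : B11Thm1.Consts` as above — `RadiiMono G`, the (9)_{β₀=1} interface on cubes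
`K ≥ 2`, the (T9ˢ) text (every rank) and the (T8) text (every rank, g6 file 3), both with the datum ranging over `sfClass (d+2) L N ε₁ 0 ∩ 𝒟_unif` (the DischargeTest
`stub_reg910Slot` SHAPE restricted to the uniform-curvature scalar data, now for every gauge group `U(n)`; the unrestricted stub is node N07's content and is NOT touched).
[cite: Balaban1985Variational, Thm 1 (8)–(10) p.279] -/
theorem slotKey_bundle_on_uniformScalar (hL : 2 ≤ L) (hN : 1 ≤ N) (C : B11Thm1.Consts) (hB : 2 ≤ C.B₃)
    (hr1 : 16 * C0 (d + 2) * (2 * Fintype.card n * (C.B₃ * C.a₁)) ≤ 3)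
    (hr2 : 1024 * ((d + 2 : ℕ) + 1 : ℝ) * ((d + 2 : ℕ) + 4) * (L : ℝ) ^ 2 * (2 * Fintype.card n * (C.B₃ * C.a₁)) ≤ 1) :
    RadiiMono (d + 2) (lipGauge (d + 2) n) ∧
    (∀ (U : B7Prop1Explicit.Site (d + 2) → Fin (d + 2) → (Matrix n n ℂ)ˣ) (x : B7Prop1Explicit.Site (d + 2)) (K : ℕ) (α₀ α₁ α₂ : ℝ), 2 ≤ K →
      lipGauge (d + 2) n U x K α₀ α₁ α₂ →
      ∃ (u : B7Prop1Explicit.Site (d + 2) → (Matrix n n ℂ)ˣ) (a : B7Prop1Explicit.Site (d + 2) → Fin (d + 2) → Matrix n n ℂ),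
        (∀ z, u z ∈ unitaryUnits (Matrix n n ℂ)) ∧
        (∀ (y : B7Prop1Explicit.Site (d + 2)) (τ : Fin (d + 2)), l1 (y - x) ≤ 2 → ((gaugeAct u U y τ : (Matrix n n ℂ)ˣ) : Matrix n n ℂ) = exp (a y τ)) ∧
        (∀ (y : B7Prop1Explicit.Site (d + 2)) (τ : Fin (d + 2)), l1 (y - x) ≤ 2 → ‖a y τ‖ ≤ α₀) ∧
        (∀ (y : B7Prop1Explicit.Site (d + 2)) (τ i : Fin (d + 2)), l1 (y - x) ≤ 1 → ‖fd i (fun z => a z τ) y‖ ≤ α₁) ∧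
        (∀ (τ i l : Fin (d + 2)), ‖fd i (fd l (fun z => a z τ)) x‖ ≤ α₂)) ∧
    (∀ (k : ℕ) (ε₁ : ℝ), 0 < ε₁ → ε₁ ≤ C.a₁ → ∀ V U : B7Prop1Explicit.Site (d + 2) → Fin (d + 2) → (Matrix n n ℂ)ˣ, V ∈ sfClass (d + 2) L N ε₁ 0 →
      V ∈ {V | ∃ (G : B7Prop1Explicit.Site (d + 2) → Fin (d + 2) → ℝ) (ω : ℝ), |ω| ≤ 1 ∧ V = scalarCfg (n := n) (fun x κ => ((G x κ : ℝ) : ℂ) * Complex.I) ∧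
        ∀ (x : B7Prop1Explicit.Site (d + 2)) (κ μ : Fin (d + 2)), κ ≠ μ → hol V x (plaqWord κ μ)
          = expUnit ((((if κ = 0 ∧ μ = 1 then ω else if κ = 1 ∧ μ = 0 then -ω else 0 : ℝ) : ℂ) * Complex.I) • (1 : Matrix n n ℂ))} →
      IsMinimiser (d + 2) (sfClass (d + 2) L N (C.B₃ * ε₁)) L N (k + 1) V U →
        ∀ x : B7Prop1Explicit.Site (d + 2), Regularity (torusVP (d + 2) L N (lipGauge (d + 2) n) (k + 1)) C.B₃ C.B₄ ε₁ U (x, L ^ (k + 1) - 1 + L ^ (k + 1) + 2)) ∧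
    (∀ (k : ℕ) (ε₁ : ℝ), 0 < ε₁ → ε₁ ≤ C.a₁ → ∀ V : B7Prop1Explicit.Site (d + 2) → Fin (d + 2) → (Matrix n n ℂ)ˣ, V ∈ sfClass (d + 2) L N ε₁ 0 →
      V ∈ {V | ∃ (G : B7Prop1Explicit.Site (d + 2) → Fin (d + 2) → ℝ) (ω : ℝ), |ω| ≤ 1 ∧ V = scalarCfg (n := n) (fun x κ => ((G x κ : ℝ) : ℂ) * Complex.I) ∧
        ∀ (x : B7Prop1Explicit.Site (d + 2)) (κ μ : Fin (d + 2)), κ ≠ μ → hol V x (plaqWord κ μ)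
          = expUnit ((((if κ = 0 ∧ μ = 1 then ω else if κ = 1 ∧ μ = 0 then -ω else 0 : ℝ) : ℂ) * Complex.I) • (1 : Matrix n n ℂ))} →
      ∃ U : B7Prop1Explicit.Site (d + 2) → Fin (d + 2) → (Matrix n n ℂ)ˣ, IsMinimiser (d + 2) (sfClass (d + 2) L N (C.B₃ * ε₁)) L N (k + 1) V U) := by
  have hc1 : (1 : ℝ) ≤ Fintype.card n := by exact_mod_cast Fintype.card_pos
  have hB0 : 0 < C.B₃ := C.B₃_pos
  have ha0 : 0 ≤ C.B₃ * C.a₁ := by have := C.a₁_pos; positivity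
  -- the rank-free regime for (T8) follows from the rank-scaled one
  have hmono : C.B₃ * C.a₁ ≤ 2 * Fintype.card n * (C.B₃ * C.a₁) := by nlinarith
  have hr1' : 16 * C0 (d + 2) * (C.B₃ * C.a₁) ≤ 3 := (mul_le_mul_of_nonneg_left hmono (by have := C0_pos (d + 2); positivity)).trans hr1
  have hr2' : 1024 * ((d + 2 : ℕ) + 1 : ℝ) * ((d + 2 : ℕ) + 4) * (L : ℝ) ^ 2 * (C.B₃ * C.a₁) ≤ 1 := (mul_le_mul_of_nonneg_left hmono (by positivity)).trans hr2
  have hr3' : C.B₃ * C.a₁ ≤ 1 / 2 := by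
    have := (regime_aux (n := n) (d := d) hL ha0 hr2).2.1; linarith
  exact ⟨radiiMono_lipGauge', fun U x K α₀ α₁ α₂ hK h => interface_lipGauge' U x K α₀ α₁ α₂ hK h,
    reg910Slot_on_uniformScalar (n := n) hL hN C hB hr1 hr2, exists8Min_on_uniformScalar (n := n) hL hN C hB hr1' hr2' hr3'⟩

end Minimisers

end

end Summit.QuantumFields.YangMills.BalabanUVNodes.N16RankNUniformScalarSlotKey
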